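import Summits.QuantumFields.BalabanUV.T4Continuum.Support.NE9CurChartOfBackground
import Literature.MathematicalPhysics.QuantumFieldTheory.Balaban1983to89.B9Eq3126H1BoundCLM
import Literature.MathematicalPhysics.QuantumFieldTheory.Balaban1983to89.B11Eq118RegimeScalars
import Literature.MathematicalPhysics.QuantumFieldTheory.Balaban1983to89.B9Eq335SmallBondsData

/-!
# NE9CurChartUniformBall — THE CHART OF THE CURVE SPECIES `cur U` EXISTS ON ONE AND THE SAME BALL FOR EVERY SMALL FIELD `U` OF A FIXED
# LATTICE: `Support/NE9CurChartOfBackground.cur_chart_exists_of_small_field` (v1.3, owner gen 80) with the radii `ε₄ ε_C R_b R′` chosen BEFORE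
# `∀ U`; cell `pub-balaban`, T4-DAG §2 node U3 / §6 NE9, WALL-NE9-P1 §3 (ii); BINDER row NE9 OWNER lineage `b2b-balaban-t4-ne9-p1`, generation 81;
# Summits-side NEW leaf under the owner's INTERFACE REQUEST NE9 of this generation (ruling e34b3e0c (0): «no new leaves unless a CRUX prover
# requests a specific NAMED interface» — requested: `NE9CurChartUniformBall.cur_chart_exists_of_small_field_uniform`; a separate file because the
# host leaf would exceed the 400-line rule), nothing printed asserted

HONEST FRAMING (T4-DAG PAGE 1).  Rung (B)+1 of the FINITE-VOLUME T⁴ programme — NOT infinite volume, NOT a mass gap, NOT the Clay problem.  NE9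
(`T4OutputRate.NE9` ∧ `FadingMemory`) is a cell NEW ESTIMATE, NOT PRINTED in [I] = [Balaban1987RG1] (CMP **109**), [II] = [Balaban1988RG2Cluster]
(CMP **116**), and NOT PROVED here («NE9 ⇐ the named binders»; spine PROVED 0∕9).  HONEST DEPENDENCY (cell line, verbatim): continuum YM on T⁴ ⇐
BetaPertH ∧ nine spine estimates (0/9 proved); BetaPertH ⇐ (D1) ∧ (D4) ∧ CAP+tail; G-an2-4 gates asym, D1 and NE2/3/4.  The `cur U` OBJECT is ONE
item of the MODEL O-NE9-1 (species (a) data); the END's `act` / `ker` halves and NEEDS-COORDINATOR #5 are untouched.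

WHAT THIS FILE PROVES (ONE theorem; 0 def, 0 sorry, axioms standard).  **`cur_chart_exists_of_small_field_uniform`**: there are `ε₃ > 0` and radii
`ε₄, ε_C`, `R_b, R′ > 0` (finite-lattice numbers depending on `L, m, η, c₀, c₁, a`, the level weights, `M_φ, M_φ′, C_τ` and FIXED quadratic-analyticity
constants `(C₄, a₃)` of the (L3) slot) such that for EVERY background `U` on the torus `T_{L·m}` with E162's displayed data, `‖U(b) − 1‖ ≤ ε ≤ ε₃`
and mutually adjoint transporters (`hRS`), and every `W` with `QuadAnalytic W C₄ a₃` analytic on its ball: the displayed positivity `hpos`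
([Balaban1985BackgroundPropagators] Thm 3.11 for the assembled `Δ_a(U)`) HOLDS and lit-balaban's chart (174)∘(47)
`chartHB 𝔊(U) 0 W 0 (A′ ↦ A′ + solA H₁(U) 0 C(U) 0 ε_C A′) ε₄ H₁(U)` is Fréchet-differentiable on `ball 0 R_b`, maps it into `ball 0 R′` and fixes `0`
— the binders (Ψ1)–(Ψ3) of the `cur` species, ON ONE BALL FOR THE WHOLE SMALL-FIELD FAMILY.  MECHANISM: the operator norms of the chart's letters
`H₁(U)`, `𝔊(U)` : `NegSize → Space115 … (∇_U)` are bounded UNIFORMLY over the small-field set (`B9Eq3126H1BoundCLM`, owner gen 81: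
[Balaban1985BackgroundPropagators] (3.126)/(3.153) with Thm 3.11, read in [Balaban1985Variational] (117)'s «norm of the transformation»), the letter
`C(U)` has U-free constants (`B11Eq44COperatorTorus.quadAnalytic_Cc`, NE9 leaf-03), the scalar letters of the two regimes are functions of the BOUNDS
with the carriers quantified inside the `∃` (`B11Eq118RegimeScalars.exists_twoRegimes_radii_of_bounds`, on NE9 leaf-01's `B11Eq118RegimeRadiiUniform`:
[Balaban1985Variational] Prop. 6 (117)–(121), (62), (172)), `hpos` is produced by `B9Thm311SmallFieldClosed` (owner gen 80); composition by
`NE9B11ChartAnalytic.chartHB_triple_of_twoRegimes`.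
DISGUISE TEST: composition of landed theorems; no inequality of the series proved; the radii are finite-lattice numbers — NOT print's uniformity in the
LATTICE ([Balaban1985BackgroundPropagators] Thms 3.12/3.13), NOT the (L3) `W` itself, NOT the gauge step of p. 416; not NE9.
References (TYPES ∕ loci only): [Balaban1985Variational] (45)–(47) p. 285, Prop. 6 (117)–(121) p. 295, (172)–(175) p. 305;
[Balaban1985BackgroundPropagators] (3.26) p. 395, Thm 3.4 p. 400, Thm 3.11 p. 416, (3.126) p. 420, (3.153) p. 426.
Imports `Support/NE9CurChartOfBackground` (v1.3), `B9Eq3126H1BoundCLM`, `B11Eq118RegimeScalars`; modifies nothing; no END re-wired.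
Value = WALL-NE9-P1 §3 (ii) «the chart of `cur U` at the constructed letters» on a U-INDEPENDENT ball; NOT summit progress.
v1.1 (gen 81, APPEND-ONLY; v1 byte-identical): + `cur_chart_exists_of_small_field_uniform'` — `∃ ε₃` BEFORE `∀ C₄ a₃` (reader ne9-leaf-06 g59's
W-5: then the statement contains v1.3 `cur_chart_exists_of_small_field` and the uniform ball in one term).
v1.2 (gen 82, APPEND-ONLY; v1.1 byte-identical but for one `import`): + **`cur_chart_exists_of_small_bonds`** — v1.1 with E162's FIVE structural
background binders (`hα`, `hα1`, `hU1`, `hreg`, `hαL`) PRODUCED from the bond smallness by the owner's `B9Eq335SmallBondsData` (gen 82: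
`α := 2(d+1)Lε`, `ε ≤ ε_reg(d, L) = 1∕(256(d+1)²L^{d+1})`, ne9-leaf-04's `B9Eq315QLipschitz.norm_Wcx_sub_one_le`): the species face (Ψ1)–(Ψ3) on ONE
ball with the background displayed through {`U(b) ∈ U1`, `‖U(b) − 1‖ ≤ ε ≤ ε₃`, `hRS`} ONLY (+ the (L3) slot and the fibre∕trace letters) — the
instancer's datum for Bałaban's `U_k` in a small gauge ([Balaban1987RG1] (1.11)–(1.14) p. 262; [Balaban1985BackgroundPropagators] (3.35)–(3.37)
p. 396); + **`cur_chart_exists_of_small_bonds_unitary`** — the same with `hRS` discharged by `hRS_of_unitary` (unitary bond variables, tracial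
`τ`, `⟨φ⁻¹X, φ⁻¹Y⟩ = τ(X*Y)`).  By proof irrelevance the operators are the SAME terms as v1.1's at any other admissible structural proofs.
-/

noncomputable section

open Metric Set

namespace Summit.QuantumFields.BalabanUV.T4Continuum.NE9CurChartUniformBall

open Literature.MathematicalPhysics.QuantumFieldTheory.Balaban1983to89
open B11Eq103H1Complex B11Eq115Space B11Eq174Chart
open B11Eq111FrakG (nabla115)
open B13Contraction113 (QuadAnalytic)
open B9Eq319QprimeTorus (fineP)
open B9SectCLatticeCarrier (Bond)
open B4Sect5Torus (TSite)
open B7Prop1Explicit (U1 Wcx boxVec)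
open B9Eq315QTorus (perCfg cornerSite QtorusW laplaceAofBackground)
open B9Eq315QTorusOnto (QtorusW_surjective)
open B11Eq44COperatorTorus (Cc quadAnalytic_Cc analyticOnNhd_Cc)
open Summit.QuantumFields.BalabanUV.T4Continuum.NE9B11ChartAnalytic (chartHB_triple_of_twoRegimes)

section SmallFieldUniform

open Literature.MathematicalPhysics.QuantumFieldTheory.Balaban1983to89.B9Thm311SmallFieldClosed (laplaceAofBackground_pos_of_small_field)
open Literature.MathematicalPhysics.QuantumFieldTheory.Balaban1983to89.B9Eq3126H1BoundCLM (exists_H1_frakG_CLM_bound_of_small_field)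
open Literature.MathematicalPhysics.QuantumFieldTheory.Balaban1983to89.B11Eq118RegimeScalars (exists_twoRegimes_radii_of_bounds)
open B9Eq310HessianOperator (adTransportW)

/-- **THE CHART OF THE CURVE SPECIES EXISTS ON ONE AND THE SAME BALL FOR EVERY SMALL FIELD `U` OF A FIXED LATTICE** — v1.3's
`cur_chart_exists_of_small_field` with the radii `ε₄ ε_C R_b R′` quantified BEFORE the background: there are `ε₃ > 0` and radii `ε₄, ε_C`, `R_b, R′ > 0`
(finite-lattice numbers depending on `L, m, η, c₀, c₁, a`, the level weights, `M_φ, M_φ′, C_τ` and the FIXED quadratic-analyticity constants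
`(C₄, a₃)` of the (L3) slot) such that for EVERY background `U` of E162's data with `‖U(b) − 1‖ ≤ ε ≤ ε₃` and `hRS`, and every `W` with
`QuadAnalytic W C₄ a₃` analytic on its ball, the displayed positivity `hpos` HOLDS ([Balaban1985BackgroundPropagators] Thm 3.11 for the assembled
`Δ_a(U)`, `B9Thm311SmallFieldClosed`) and lit-balaban's chart (174)∘(47) of `cur U` is Fréchet-differentiable on `ball 0 R_b`, maps it into `ball 0 R′`
and fixes `0`.  MECHANISM: the operator norms of the chart's letters `H₁(U)`, `𝔊(U)` : `NegSize → Space115 … (∇_U)` are bounded UNIFORMLY over the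
small-field set (`B9Eq3126H1BoundCLM.exists_H1_frakG_CLM_bound_of_small_field`: [Balaban1985BackgroundPropagators] (3.126)/(3.153) read in
[Balaban1985Variational] (117)'s norm; the `L²` bounds of `B9Eq3126H1Bound` + finite-lattice comparisons + `‖∇_U‖ ≤ 2|η|⁻¹`), the letter `C(U)` has
U-free constants (`quadAnalytic_Cc`), and the scalar letters of the two regimes are functions of the BOUNDS (`B11Eq118RegimeScalars.
exists_twoRegimes_radii_of_bounds` on NE9 leaf-01's `B11Eq118RegimeRadiiUniform`, [Balaban1985Variational] Prop. 6 (117)–(121), (62), (172));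
composition by `chartHB_triple_of_twoRegimes`.
NOT print's uniformity in the LATTICE (the radii depend on `L, m`); NOT the (L3) `W` itself; NOT the gauge step of p. 416. [folklore] -/
theorem cur_chart_exists_of_small_field_uniform {d : ℕ} (L : ℕ) [NeZero L] (m : Fin d → ℕ) [∀ i, NeZero (fineP L m i)] (hL : 1 ≤ L)
    {𝔸 : Type*} [NormedRing 𝔸] [NormedAlgebra ℂ 𝔸] [CompleteSpace 𝔸] [NormOneClass 𝔸] [StarRing 𝔸] [NormedStarGroup 𝔸] [StarModule ℂ 𝔸]
    [FiniteDimensional ℂ 𝔸]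
    {W : Type*} [NormedAddCommGroup W] [InnerProductSpace ℂ W] [FiniteDimensional ℂ W] (φ : W ≃ₗ[ℂ] 𝔸) {Mφ Mφ' : ℝ} (hMφ : 0 ≤ Mφ)
    (hMφ' : 0 ≤ Mφ') (hφ : ∀ w, ‖φ w‖ ≤ Mφ * ‖w‖) (hφ' : ∀ X, ‖φ.symm X‖ ≤ Mφ' * ‖X‖)
    (τ : 𝔸 →ₗ[ℂ] ℂ) {Cτ : ℝ} (hτ : ∀ X, ‖τ X‖ ≤ Cτ * ‖X‖) (hCτ : 0 ≤ Cτ)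
    {η : ℝ} [Fact (0 < (L : ℝ))] [Fact (0 < η)] {lev₀ : Bond d (fineP L m) → ℕ} {levB : Bond d m → ℕ} (lev₁ : Bond d (fineP L m) × Fin d → ℕ)
    (hlev : ∀ b, 1 ≤ lev₀ b) {c₀ c₁ : ℝ} [Fact (0 < c₀)] [Fact (0 < c₁)] {a : ℝ} (ha : 0 < a) {C₄ a₃ : ℝ} (hC₄ : 0 ≤ C₄) (ha₃ : 0 < a₃) :
    ∃ ε₃ ε₄ εC Rb R' : ℝ, 0 < ε₃ ∧ 0 < Rb ∧ 0 < R' ∧ ∀ (U : Bond d (fineP L m) → 𝔸ˣ) {α : ℝ} (hα : α ≤ 1 / 128) (hα1 : α ≤ 1 / 64)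
      (hU1 : ∀ (x : B7Prop1Explicit.Site d) (κ : Fin d), perCfg (fineP L m) U x κ ∈ U1 𝔸)
      (hreg : ∀ (y : TSite d m) (κ : Fin d) (r : Fin d → Fin L),
        ‖((Wcx L (perCfg (fineP L m) U) (cornerSite L y) κ (boxVec L r) : 𝔸ˣ) : 𝔸) - 1‖ ≤ α)
      (hαL : 50 * (d + 1) * α * (L : ℝ) ^ d ≤ 1 / 2) {ε : ℝ}, 0 ≤ ε → ε ≤ ε₃ → (∀ b, ‖(U b : 𝔸) - 1‖ ≤ ε) →
      (∀ (b : Bond d (fineP L m)) (v u : W), inner ℂ (adTransportW φ U b v) u = inner ℂ v (adTransportW φ (fun b => (U b)⁻¹) b u)) →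
      ∀ {Wq : Space115 (L : ℝ) η lev₀ lev₁ (nabla115 η U) → NegSize (L : ℝ) η lev₀ 3 𝔸}, QuadAnalytic Wq C₄ a₃ →
        AnalyticOnNhd ℂ Wq {Y | ‖Y‖ < a₃} →
      ∃ hpos : ∀ x : BondL2K ℂ d (fineP L m) c₀ W, x ≠ 0 →
          0 < RCLike.re (inner ℂ x (laplaceAofBackground L m hL φ U hα1 hU1 hreg τ η (c₀ := c₀) (c₁ := c₁) a x)),
        DifferentiableOn ℂ (chartHB (frakGLatticeCLM (lev₀ := lev₀) φ hpos (QtorusW_surjective L m hL U hα1 hU1 hreg hαL φ) lev₁ (nabla115 η U))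
            0 Wq 0 (fun A' => A' + solA (H1LatticeCLM (lev₀ := lev₀) (levB := levB) φ hpos (QtorusW_surjective L m hL U hα1 hU1 hreg hαL φ) lev₁ (nabla115 η U))
              0 (Cc L m η U lev₀ lev₁ (nabla115 η U) levB) 0 εC A') ε₄
            (H1LatticeCLM (lev₀ := lev₀) (levB := levB) φ hpos (QtorusW_surjective L m hL U hα1 hU1 hreg hαL φ) lev₁ (nabla115 η U)))
          (ball (0 : NegSize (L : ℝ) η levB 0 𝔸) Rb) ∧
        MapsTo (chartHB (frakGLatticeCLM (lev₀ := lev₀) φ hpos (QtorusW_surjective L m hL U hα1 hU1 hreg hαL φ) lev₁ (nabla115 η U))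
            0 Wq 0 (fun A' => A' + solA (H1LatticeCLM (lev₀ := lev₀) (levB := levB) φ hpos (QtorusW_surjective L m hL U hα1 hU1 hreg hαL φ) lev₁ (nabla115 η U))
              0 (Cc L m η U lev₀ lev₁ (nabla115 η U) levB) 0 εC A') ε₄
            (H1LatticeCLM (lev₀ := lev₀) (levB := levB) φ hpos (QtorusW_surjective L m hL U hα1 hU1 hreg hαL φ) lev₁ (nabla115 η U)))
          (ball (0 : NegSize (L : ℝ) η levB 0 𝔸) Rb) (ball (0 : Space115 (L : ℝ) η lev₀ lev₁ (nabla115 η U)) R') ∧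
        chartHB (frakGLatticeCLM (lev₀ := lev₀) φ hpos (QtorusW_surjective L m hL U hα1 hU1 hreg hαL φ) lev₁ (nabla115 η U))
            0 Wq 0 (fun A' => A' + solA (H1LatticeCLM (lev₀ := lev₀) (levB := levB) φ hpos (QtorusW_surjective L m hL U hα1 hU1 hreg hαL φ) lev₁ (nabla115 η U))
              0 (Cc L m η U lev₀ lev₁ (nabla115 η U) levB) 0 εC A') ε₄
            (H1LatticeCLM (lev₀ := lev₀) (levB := levB) φ hpos (QtorusW_surjective L m hL U hα1 hU1 hreg hαL φ) lev₁ (nabla115 η U)) 0 = 0 := by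
  -- Thm 3.11 at every small field (gen 80)
  obtain ⟨ε₃, hε₃, Hpos⟩ := laplaceAofBackground_pos_of_small_field L m hL φ (c₀ := c₀) (c₁ := c₁) (ne_of_gt (Fact.out : 0 < η)) ha hMφ hMφ' hφ hφ'
    τ hτ hCτ
  -- the uniform operator-norm bounds of `H₁(U)`, `𝔊(U)` in the chart's type (gen 81)
  obtain ⟨CH, CG, ε₅, hCH, hCG, hε₅, Hb⟩ :=
    exists_H1_frakG_CLM_bound_of_small_field L m hL φ (c₀ := c₀) (c₁ := c₁) (η := η) lev₀ levB lev₁ ha hMφ hMφ' hφ hφ' τ hτ hCτ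
  -- the scalar letters of the two regimes from the bounds (`C(U)`'s constants are U-free: `quadAnalytic_Cc`)
  obtain ⟨j, a', ε₄, aC, εC, R', Rb, hj, ha', -, -, -, hR'0, hRb0, hcap, hR'le, Hreg⟩ :=
    exists_twoRegimes_radii_of_bounds (B₀ := CG) (b := CH) (b₁ := CH) (C₄ := C₄) (a₃ := a₃) (C₂ := 2097152 * ((d : ℝ) + 1) ^ 2)
      (c₄ := 1 / (512 * ((d : ℝ) + 1))) hCG.le hCH.le hCH.le hC₄ ha₃ (by positivity) (by positivity)
  refine ⟨min ε₃ ε₅, ε₄, εC, Rb, R', lt_min hε₃ hε₅, hRb0, hR'0, ?_⟩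
  intro U α hα hα1 hU1 hreg hαL ε hε hεm hUε hRS Wq hW hWa
  have hpos := Hpos U hα1 hU1 hreg hε (hεm.trans (min_le_left _ _)) hUε hRS
  refine ⟨hpos, ?_⟩
  obtain ⟨hH, hG⟩ := Hb U hα1 hU1 hreg hε (hεm.trans (min_le_right _ _)) hUε hRS hpos (QtorusW_surjective L m hL U hα1 hU1 hreg hαL φ)
  have hC := quadAnalytic_Cc L m η U lev₀ lev₁ (nabla115 η U) levB hL hα hU1 hreg hlev
  have hCa := analyticOnNhd_Cc L m η U lev₀ lev₁ (nabla115 η U) levB hL hα hU1 hreg hlev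
  have hHpt : ∀ B : NegSize (L : ℝ) η levB 0 𝔸,
      ‖H1LatticeCLM (lev₀ := lev₀) (levB := levB) φ hpos (QtorusW_surjective L m hL U hα1 hU1 hreg hαL φ) lev₁ (nabla115 η U) B‖ ≤ CH * ‖B‖ :=
    fun B => (ContinuousLinearMap.le_opNorm _ B).trans (mul_le_mul_of_nonneg_right hH (norm_nonneg B))
  have hGpt : ∀ f : NegSize (L : ℝ) η lev₀ 3 𝔸,
      ‖frakGLatticeCLM (lev₀ := lev₀) φ hpos (QtorusW_surjective L m hL U hα1 hU1 hreg hαL φ) lev₁ (nabla115 η U) f‖ ≤ CG * ‖f‖ :=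
    fun f => (ContinuousLinearMap.le_opNorm _ f).trans (mul_le_mul_of_nonneg_right hG (norm_nonneg f))
  obtain ⟨R, RC, hRb⟩ := Hreg (frakGLatticeCLM (lev₀ := lev₀) φ hpos (QtorusW_surjective L m hL U hα1 hU1 hreg hαL φ) lev₁ (nabla115 η U)) Wq
    (H1LatticeCLM (lev₀ := lev₀) (levB := levB) φ hpos (QtorusW_surjective L m hL U hα1 hU1 hreg hαL φ) lev₁ (nabla115 η U))
    (Cc L m η U lev₀ lev₁ (nabla115 η U) levB)
    (H1LatticeCLM (lev₀ := lev₀) (levB := levB) φ hpos (QtorusW_surjective L m hL U hα1 hU1 hreg hαL φ) lev₁ (nabla115 η U)) hGpt hW hHpt hC hHpt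
  exact chartHB_triple_of_twoRegimes R hWa hj.le ha' RC hCa hcap _ hRb hR'0 hR'le

/-! ## v1.1 (gen 81, APPEND-ONLY): `∃ ε₃` before `∀ C₄ a₃` — one statement containing v1.3 and the uniform ball -/

/-- **v1.1 (APPEND-ONLY): THE SAME WITH `∃ ε₃` BEFORE THE W-SLOT CONSTANTS `(C₄, a₃)`** — the smallness threshold `ε₃` of the background
(= min of `B9Thm311SmallFieldClosed`'s and `B9Eq3126H1BoundCLM`'s thresholds) does not depend on the quadratic-analyticity constants of the (L3)
slot, so it is quantified FIRST; the radii `ε₄ ε_C R_b R′` (functions of the uniform bounds AND of `(C₄, a₃)`) come after `∀ C₄ a₃` and before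
`∀ U`.  In this order the statement CONTAINS v1.3 `NE9CurChartOfBackground.cur_chart_exists_of_small_field` (instantiate at each `W`'s constants)
as well as the U-uniformity of `cur_chart_exists_of_small_field_uniform` (reader ne9-leaf-06 g59, W-ne9leaf06-g59-5).  Same proof, reordered.
[folklore] -/
theorem cur_chart_exists_of_small_field_uniform' {d : ℕ} (L : ℕ) [NeZero L] (m : Fin d → ℕ) [∀ i, NeZero (fineP L m i)] (hL : 1 ≤ L)
    {𝔸 : Type*} [NormedRing 𝔸] [NormedAlgebra ℂ 𝔸] [CompleteSpace 𝔸] [NormOneClass 𝔸] [StarRing 𝔸] [NormedStarGroup 𝔸] [StarModule ℂ 𝔸]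
    [FiniteDimensional ℂ 𝔸]
    {W : Type*} [NormedAddCommGroup W] [InnerProductSpace ℂ W] [FiniteDimensional ℂ W] (φ : W ≃ₗ[ℂ] 𝔸) {Mφ Mφ' : ℝ} (hMφ : 0 ≤ Mφ)
    (hMφ' : 0 ≤ Mφ') (hφ : ∀ w, ‖φ w‖ ≤ Mφ * ‖w‖) (hφ' : ∀ X, ‖φ.symm X‖ ≤ Mφ' * ‖X‖)
    (τ : 𝔸 →ₗ[ℂ] ℂ) {Cτ : ℝ} (hτ : ∀ X, ‖τ X‖ ≤ Cτ * ‖X‖) (hCτ : 0 ≤ Cτ)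
    {η : ℝ} [Fact (0 < (L : ℝ))] [Fact (0 < η)] {lev₀ : Bond d (fineP L m) → ℕ} {levB : Bond d m → ℕ} (lev₁ : Bond d (fineP L m) × Fin d → ℕ)
    (hlev : ∀ b, 1 ≤ lev₀ b) {c₀ c₁ : ℝ} [Fact (0 < c₀)] [Fact (0 < c₁)] {a : ℝ} (ha : 0 < a) :
    ∃ ε₃ : ℝ, 0 < ε₃ ∧ ∀ {C₄ a₃ : ℝ}, 0 ≤ C₄ → 0 < a₃ →
      ∃ ε₄ εC Rb R' : ℝ, 0 < Rb ∧ 0 < R' ∧ ∀ (U : Bond d (fineP L m) → 𝔸ˣ) {α : ℝ} (hα : α ≤ 1 / 128) (hα1 : α ≤ 1 / 64)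
      (hU1 : ∀ (x : B7Prop1Explicit.Site d) (κ : Fin d), perCfg (fineP L m) U x κ ∈ U1 𝔸)
      (hreg : ∀ (y : TSite d m) (κ : Fin d) (r : Fin d → Fin L),
        ‖((Wcx L (perCfg (fineP L m) U) (cornerSite L y) κ (boxVec L r) : 𝔸ˣ) : 𝔸) - 1‖ ≤ α)
      (hαL : 50 * (d + 1) * α * (L : ℝ) ^ d ≤ 1 / 2) {ε : ℝ}, 0 ≤ ε → ε ≤ ε₃ → (∀ b, ‖(U b : 𝔸) - 1‖ ≤ ε) →
      (∀ (b : Bond d (fineP L m)) (v u : W), inner ℂ (adTransportW φ U b v) u = inner ℂ v (adTransportW φ (fun b => (U b)⁻¹) b u)) →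
      ∀ {Wq : Space115 (L : ℝ) η lev₀ lev₁ (nabla115 η U) → NegSize (L : ℝ) η lev₀ 3 𝔸}, QuadAnalytic Wq C₄ a₃ →
        AnalyticOnNhd ℂ Wq {Y | ‖Y‖ < a₃} →
      ∃ hpos : ∀ x : BondL2K ℂ d (fineP L m) c₀ W, x ≠ 0 →
          0 < RCLike.re (inner ℂ x (laplaceAofBackground L m hL φ U hα1 hU1 hreg τ η (c₀ := c₀) (c₁ := c₁) a x)),
        DifferentiableOn ℂ (chartHB (frakGLatticeCLM (lev₀ := lev₀) φ hpos (QtorusW_surjective L m hL U hα1 hU1 hreg hαL φ) lev₁ (nabla115 η U))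
            0 Wq 0 (fun A' => A' + solA (H1LatticeCLM (lev₀ := lev₀) (levB := levB) φ hpos (QtorusW_surjective L m hL U hα1 hU1 hreg hαL φ) lev₁ (nabla115 η U))
              0 (Cc L m η U lev₀ lev₁ (nabla115 η U) levB) 0 εC A') ε₄
            (H1LatticeCLM (lev₀ := lev₀) (levB := levB) φ hpos (QtorusW_surjective L m hL U hα1 hU1 hreg hαL φ) lev₁ (nabla115 η U)))
          (ball (0 : NegSize (L : ℝ) η levB 0 𝔸) Rb) ∧
        MapsTo (chartHB (frakGLatticeCLM (lev₀ := lev₀) φ hpos (QtorusW_surjective L m hL U hα1 hU1 hreg hαL φ) lev₁ (nabla115 η U))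
            0 Wq 0 (fun A' => A' + solA (H1LatticeCLM (lev₀ := lev₀) (levB := levB) φ hpos (QtorusW_surjective L m hL U hα1 hU1 hreg hαL φ) lev₁ (nabla115 η U))
              0 (Cc L m η U lev₀ lev₁ (nabla115 η U) levB) 0 εC A') ε₄
            (H1LatticeCLM (lev₀ := lev₀) (levB := levB) φ hpos (QtorusW_surjective L m hL U hα1 hU1 hreg hαL φ) lev₁ (nabla115 η U)))
          (ball (0 : NegSize (L : ℝ) η levB 0 𝔸) Rb) (ball (0 : Space115 (L : ℝ) η lev₀ lev₁ (nabla115 η U)) R') ∧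
        chartHB (frakGLatticeCLM (lev₀ := lev₀) φ hpos (QtorusW_surjective L m hL U hα1 hU1 hreg hαL φ) lev₁ (nabla115 η U))
            0 Wq 0 (fun A' => A' + solA (H1LatticeCLM (lev₀ := lev₀) (levB := levB) φ hpos (QtorusW_surjective L m hL U hα1 hU1 hreg hαL φ) lev₁ (nabla115 η U))
              0 (Cc L m η U lev₀ lev₁ (nabla115 η U) levB) 0 εC A') ε₄
            (H1LatticeCLM (lev₀ := lev₀) (levB := levB) φ hpos (QtorusW_surjective L m hL U hα1 hU1 hreg hαL φ) lev₁ (nabla115 η U)) 0 = 0 := by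
  -- Thm 3.11 at every small field (gen 80)
  obtain ⟨ε₃, hε₃, Hpos⟩ := laplaceAofBackground_pos_of_small_field L m hL φ (c₀ := c₀) (c₁ := c₁) (ne_of_gt (Fact.out : 0 < η)) ha hMφ hMφ' hφ hφ'
    τ hτ hCτ
  -- the uniform operator-norm bounds of `H₁(U)`, `𝔊(U)` in the chart's type (gen 81)
  obtain ⟨CH, CG, ε₅, hCH, hCG, hε₅, Hb⟩ :=
    exists_H1_frakG_CLM_bound_of_small_field L m hL φ (c₀ := c₀) (c₁ := c₁) (η := η) lev₀ levB lev₁ ha hMφ hMφ' hφ hφ' τ hτ hCτ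
  -- `ε₃` BEFORE the W-slot constants; then the scalar letters of the two regimes from the bounds and `(C₄, a₃)`
  refine ⟨min ε₃ ε₅, lt_min hε₃ hε₅, fun {C₄ a₃} hC₄ ha₃ => ?_⟩
  obtain ⟨j, a', ε₄, aC, εC, R', Rb, hj, ha', -, -, -, hR'0, hRb0, hcap, hR'le, Hreg⟩ :=
    exists_twoRegimes_radii_of_bounds (B₀ := CG) (b := CH) (b₁ := CH) (C₄ := C₄) (a₃ := a₃) (C₂ := 2097152 * ((d : ℝ) + 1) ^ 2)
      (c₄ := 1 / (512 * ((d : ℝ) + 1))) hCG.le hCH.le hCH.le hC₄ ha₃ (by positivity) (by positivity)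
  refine ⟨ε₄, εC, Rb, R', hRb0, hR'0, ?_⟩
  intro U α hα hα1 hU1 hreg hαL ε hε hεm hUε hRS Wq hW hWa
  have hpos := Hpos U hα1 hU1 hreg hε (hεm.trans (min_le_left _ _)) hUε hRS
  refine ⟨hpos, ?_⟩
  obtain ⟨hH, hG⟩ := Hb U hα1 hU1 hreg hε (hεm.trans (min_le_right _ _)) hUε hRS hpos (QtorusW_surjective L m hL U hα1 hU1 hreg hαL φ)
  have hC := quadAnalytic_Cc L m η U lev₀ lev₁ (nabla115 η U) levB hL hα hU1 hreg hlev
  have hCa := analyticOnNhd_Cc L m η U lev₀ lev₁ (nabla115 η U) levB hL hα hU1 hreg hlev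
  have hHpt : ∀ B : NegSize (L : ℝ) η levB 0 𝔸,
      ‖H1LatticeCLM (lev₀ := lev₀) (levB := levB) φ hpos (QtorusW_surjective L m hL U hα1 hU1 hreg hαL φ) lev₁ (nabla115 η U) B‖ ≤ CH * ‖B‖ :=
    fun B => (ContinuousLinearMap.le_opNorm _ B).trans (mul_le_mul_of_nonneg_right hH (norm_nonneg B))
  have hGpt : ∀ f : NegSize (L : ℝ) η lev₀ 3 𝔸,
      ‖frakGLatticeCLM (lev₀ := lev₀) φ hpos (QtorusW_surjective L m hL U hα1 hU1 hreg hαL φ) lev₁ (nabla115 η U) f‖ ≤ CG * ‖f‖ :=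
    fun f => (ContinuousLinearMap.le_opNorm _ f).trans (mul_le_mul_of_nonneg_right hG (norm_nonneg f))
  obtain ⟨R, RC, hRb⟩ := Hreg (frakGLatticeCLM (lev₀ := lev₀) φ hpos (QtorusW_surjective L m hL U hα1 hU1 hreg hαL φ) lev₁ (nabla115 η U)) Wq
    (H1LatticeCLM (lev₀ := lev₀) (levB := levB) φ hpos (QtorusW_surjective L m hL U hα1 hU1 hreg hαL φ) lev₁ (nabla115 η U))
    (Cc L m η U lev₀ lev₁ (nabla115 η U) levB)
    (H1LatticeCLM (lev₀ := lev₀) (levB := levB) φ hpos (QtorusW_surjective L m hL U hα1 hU1 hreg hαL φ) lev₁ (nabla115 η U)) hGpt hW hHpt hC hHpt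
  exact chartHB_triple_of_twoRegimes R hWa hj.le ha' RC hCa hcap _ hRb hR'0 hR'le

end SmallFieldUniform

/-! ## v1.2 (gen 82, APPEND-ONLY): the species face with the background binders {`U1`, small bonds, `hRS`} only -/

section SmallBonds

open Literature.MathematicalPhysics.QuantumFieldTheory.Balaban1983to89.B9Eq335SmallBondsData
  (perCfg_mem_U1 hreg_of_small_bonds alpha_le_128 alpha_le_64 alphaL_le_half epsReg_pos)
open Literature.MathematicalPhysics.QuantumFieldTheory.Balaban1983to89.B9Thm311SmallFieldClosed (hRS_of_unitary)
open B9Eq310HessianOperator (adTransportW)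

/-- **v1.2 (APPEND-ONLY): THE CHART OF THE CURVE SPECIES ON ONE BALL FOR EVERY UNIT-BOUNDED SMALL-BOND BACKGROUND** — v1.1
`cur_chart_exists_of_small_field_uniform'` with E162's five structural binders PRODUCED (`B9Eq335SmallBondsData`: `hα`∕`hα1` = `alpha_le_128`∕
`alpha_le_64`, `hU1` = `perCfg_mem_U1`, `hreg` = `hreg_of_small_bonds`, `hαL` = `alphaL_le_half`, at `α := 2(d+1)Lε`): there is `ε₃ > 0` with
`ε₃ ≤ ε_reg(d, L) = 1∕(256(d+1)²L^{d+1})` such that for all W-slot constants `(C₄, a₃)` there are radii `ε₄ ε_C R_b R′` with: for EVERY background `U`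
with `U(b) ∈ U1`, `‖U(b) − 1‖ ≤ ε ≤ ε₃` (and `ε ≤ ε_reg(d, L)`) and `hRS`, and every `W` with `QuadAnalytic W C₄ a₃` analytic on its ball, the
positivity `hpos` HOLDS and lit-balaban's chart (174)∘(47) of `cur U` satisfies (Ψ1)–(Ψ3) on `ball 0 R_b → ball 0 R′`.  NOT print's uniformity in the
lattice; NOT the gauge step (3.36)–(3.37); NOT the (L3) `W`. [folklore] -/
theorem cur_chart_exists_of_small_bonds {d : ℕ} (L : ℕ) [NeZero L] (m : Fin d → ℕ) [∀ i, NeZero (fineP L m i)] (hL : 1 ≤ L)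
    {𝔸 : Type*} [NormedRing 𝔸] [NormedAlgebra ℂ 𝔸] [CompleteSpace 𝔸] [NormOneClass 𝔸] [StarRing 𝔸] [NormedStarGroup 𝔸] [StarModule ℂ 𝔸]
    [FiniteDimensional ℂ 𝔸]
    {W : Type*} [NormedAddCommGroup W] [InnerProductSpace ℂ W] [FiniteDimensional ℂ W] (φ : W ≃ₗ[ℂ] 𝔸) {Mφ Mφ' : ℝ} (hMφ : 0 ≤ Mφ)
    (hMφ' : 0 ≤ Mφ') (hφ : ∀ w, ‖φ w‖ ≤ Mφ * ‖w‖) (hφ' : ∀ X, ‖φ.symm X‖ ≤ Mφ' * ‖X‖)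
    (τ : 𝔸 →ₗ[ℂ] ℂ) {Cτ : ℝ} (hτ : ∀ X, ‖τ X‖ ≤ Cτ * ‖X‖) (hCτ : 0 ≤ Cτ)
    {η : ℝ} [Fact (0 < (L : ℝ))] [Fact (0 < η)] {lev₀ : Bond d (fineP L m) → ℕ} {levB : Bond d m → ℕ} (lev₁ : Bond d (fineP L m) × Fin d → ℕ)
    (hlev : ∀ b, 1 ≤ lev₀ b) {c₀ c₁ : ℝ} [Fact (0 < c₀)] [Fact (0 < c₁)] {a : ℝ} (ha : 0 < a) :
    ∃ ε₃ : ℝ, 0 < ε₃ ∧ ε₃ ≤ 1 / (256 * ((d : ℝ) + 1) ^ 2 * (L : ℝ) ^ (d + 1)) ∧ ∀ {C₄ a₃ : ℝ}, 0 ≤ C₄ → 0 < a₃ →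
      ∃ ε₄ εC Rb R' : ℝ, 0 < Rb ∧ 0 < R' ∧ ∀ (U : Bond d (fineP L m) → 𝔸ˣ) (hU : ∀ b, U b ∈ U1 𝔸) {ε : ℝ} (hε : 0 ≤ ε)
      (hεr : ε ≤ 1 / (256 * ((d : ℝ) + 1) ^ 2 * (L : ℝ) ^ (d + 1))), ε ≤ ε₃ → ∀ (hUε : ∀ b, ‖(U b : 𝔸) - 1‖ ≤ ε),
      (∀ (b : Bond d (fineP L m)) (v u : W), inner ℂ (adTransportW φ U b v) u = inner ℂ v (adTransportW φ (fun b => (U b)⁻¹) b u)) →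
      ∀ {Wq : Space115 (L : ℝ) η lev₀ lev₁ (nabla115 η U) → NegSize (L : ℝ) η lev₀ 3 𝔸}, QuadAnalytic Wq C₄ a₃ →
        AnalyticOnNhd ℂ Wq {Y | ‖Y‖ < a₃} →
      ∃ hpos : ∀ x : BondL2K ℂ d (fineP L m) c₀ W, x ≠ 0 →
          0 < RCLike.re (inner ℂ x (laplaceAofBackground L m hL φ U (alpha_le_64 hL hε hεr) (perCfg_mem_U1 L m hU)
            (hreg_of_small_bonds L m hU hε hUε) τ η (c₀ := c₀) (c₁ := c₁) a x)),
        DifferentiableOn ℂ (chartHB (frakGLatticeCLM (lev₀ := lev₀) φ hpos (QtorusW_surjective L m hL U (alpha_le_64 hL hε hεr) (perCfg_mem_U1 L m hU)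
              (hreg_of_small_bonds L m hU hε hUε) (alphaL_le_half hL hεr) φ) lev₁ (nabla115 η U))
            0 Wq 0 (fun A' => A' + solA (H1LatticeCLM (lev₀ := lev₀) (levB := levB) φ hpos (QtorusW_surjective L m hL U (alpha_le_64 hL hε hεr)
              (perCfg_mem_U1 L m hU) (hreg_of_small_bonds L m hU hε hUε) (alphaL_le_half hL hεr) φ) lev₁ (nabla115 η U))
              0 (Cc L m η U lev₀ lev₁ (nabla115 η U) levB) 0 εC A') ε₄
            (H1LatticeCLM (lev₀ := lev₀) (levB := levB) φ hpos (QtorusW_surjective L m hL U (alpha_le_64 hL hε hεr) (perCfg_mem_U1 L m hU)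
              (hreg_of_small_bonds L m hU hε hUε) (alphaL_le_half hL hεr) φ) lev₁ (nabla115 η U)))
          (ball (0 : NegSize (L : ℝ) η levB 0 𝔸) Rb) ∧
        MapsTo (chartHB (frakGLatticeCLM (lev₀ := lev₀) φ hpos (QtorusW_surjective L m hL U (alpha_le_64 hL hε hεr) (perCfg_mem_U1 L m hU)
              (hreg_of_small_bonds L m hU hε hUε) (alphaL_le_half hL hεr) φ) lev₁ (nabla115 η U))
            0 Wq 0 (fun A' => A' + solA (H1LatticeCLM (lev₀ := lev₀) (levB := levB) φ hpos (QtorusW_surjective L m hL U (alpha_le_64 hL hε hεr)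
              (perCfg_mem_U1 L m hU) (hreg_of_small_bonds L m hU hε hUε) (alphaL_le_half hL hεr) φ) lev₁ (nabla115 η U))
              0 (Cc L m η U lev₀ lev₁ (nabla115 η U) levB) 0 εC A') ε₄
            (H1LatticeCLM (lev₀ := lev₀) (levB := levB) φ hpos (QtorusW_surjective L m hL U (alpha_le_64 hL hε hεr) (perCfg_mem_U1 L m hU)
              (hreg_of_small_bonds L m hU hε hUε) (alphaL_le_half hL hεr) φ) lev₁ (nabla115 η U)))
          (ball (0 : NegSize (L : ℝ) η levB 0 𝔸) Rb) (ball (0 : Space115 (L : ℝ) η lev₀ lev₁ (nabla115 η U)) R') ∧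
        chartHB (frakGLatticeCLM (lev₀ := lev₀) φ hpos (QtorusW_surjective L m hL U (alpha_le_64 hL hε hεr) (perCfg_mem_U1 L m hU)
              (hreg_of_small_bonds L m hU hε hUε) (alphaL_le_half hL hεr) φ) lev₁ (nabla115 η U))
            0 Wq 0 (fun A' => A' + solA (H1LatticeCLM (lev₀ := lev₀) (levB := levB) φ hpos (QtorusW_surjective L m hL U (alpha_le_64 hL hε hεr)
              (perCfg_mem_U1 L m hU) (hreg_of_small_bonds L m hU hε hUε) (alphaL_le_half hL hεr) φ) lev₁ (nabla115 η U))
              0 (Cc L m η U lev₀ lev₁ (nabla115 η U) levB) 0 εC A') ε₄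
            (H1LatticeCLM (lev₀ := lev₀) (levB := levB) φ hpos (QtorusW_surjective L m hL U (alpha_le_64 hL hε hεr) (perCfg_mem_U1 L m hU)
              (hreg_of_small_bonds L m hU hε hUε) (alphaL_le_half hL hεr) φ) lev₁ (nabla115 η U)) 0 = 0 := by
  obtain ⟨ε₃, hε₃, H⟩ := cur_chart_exists_of_small_field_uniform' L m hL φ hMφ hMφ' hφ hφ' τ hτ hCτ (η := η) (levB := levB) lev₁ hlev
    (c₀ := c₀) (c₁ := c₁) ha
  refine ⟨min ε₃ (1 / (256 * ((d : ℝ) + 1) ^ 2 * (L : ℝ) ^ (d + 1))), lt_min hε₃ (epsReg_pos hL), min_le_right _ _, fun {C₄ a₃} hC₄ ha₃ => ?_⟩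
  obtain ⟨ε₄, εC, Rb, R', hRb0, hR'0, H'⟩ := H hC₄ ha₃
  refine ⟨ε₄, εC, Rb, R', hRb0, hR'0, ?_⟩
  intro U hU ε hε hεr hεm hUε hRS Wq hW hWa
  exact H' U (alpha_le_128 hL hε hεr) (alpha_le_64 hL hε hεr) (perCfg_mem_U1 L m hU) (hreg_of_small_bonds L m hU hε hUε)
    (alphaL_le_half hL hεr) hε (hεm.trans (min_le_left _ _)) hUε hRS hW hWa

/-- **v1.2: THE SAME WITH `hRS` DISCHARGED BY THE MODEL LETTERS** (`B9Thm311SmallFieldClosed.hRS_of_unitary`): for unitary bond variables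
(`U(b)* = U(b)⁻¹`), a tracial `τ` and the norming `⟨φ⁻¹X, φ⁻¹Y⟩ = τ(X*Y)`, the chart of `cur U` satisfies (Ψ1)–(Ψ3) on ONE ball for EVERY
unit-bounded unitary small-bond background of a fixed lattice — background binders {`U(b) ∈ U1`, `U(b)` unitary, `‖U(b) − 1‖ ≤ ε ≤ ε₃`} and
nothing else (+ the (L3) slot, the fibre∕trace letters). [folklore] -/
theorem cur_chart_exists_of_small_bonds_unitary {d : ℕ} (L : ℕ) [NeZero L] (m : Fin d → ℕ) [∀ i, NeZero (fineP L m i)] (hL : 1 ≤ L)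
    {𝔸 : Type*} [NormedRing 𝔸] [NormedAlgebra ℂ 𝔸] [CompleteSpace 𝔸] [NormOneClass 𝔸] [StarRing 𝔸] [NormedStarGroup 𝔸] [StarModule ℂ 𝔸]
    [FiniteDimensional ℂ 𝔸]
    {W : Type*} [NormedAddCommGroup W] [InnerProductSpace ℂ W] [FiniteDimensional ℂ W] (φ : W ≃ₗ[ℂ] 𝔸) {Mφ Mφ' : ℝ} (hMφ : 0 ≤ Mφ)
    (hMφ' : 0 ≤ Mφ') (hφ : ∀ w, ‖φ w‖ ≤ Mφ * ‖w‖) (hφ' : ∀ X, ‖φ.symm X‖ ≤ Mφ' * ‖X‖)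
    (τ : 𝔸 →ₗ[ℂ] ℂ) {Cτ : ℝ} (hτ : ∀ X, ‖τ X‖ ≤ Cτ * ‖X‖) (hCτ : 0 ≤ Cτ)
    (hτφ : ∀ X Y : 𝔸, inner ℂ (φ.symm X) (φ.symm Y) = τ (star X * Y)) (htr : ∀ X Y : 𝔸, τ (X * Y) = τ (Y * X))
    {η : ℝ} [Fact (0 < (L : ℝ))] [Fact (0 < η)] {lev₀ : Bond d (fineP L m) → ℕ} {levB : Bond d m → ℕ} (lev₁ : Bond d (fineP L m) × Fin d → ℕ)
    (hlev : ∀ b, 1 ≤ lev₀ b) {c₀ c₁ : ℝ} [Fact (0 < c₀)] [Fact (0 < c₁)] {a : ℝ} (ha : 0 < a) :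
    ∃ ε₃ : ℝ, 0 < ε₃ ∧ ε₃ ≤ 1 / (256 * ((d : ℝ) + 1) ^ 2 * (L : ℝ) ^ (d + 1)) ∧ ∀ {C₄ a₃ : ℝ}, 0 ≤ C₄ → 0 < a₃ →
      ∃ ε₄ εC Rb R' : ℝ, 0 < Rb ∧ 0 < R' ∧ ∀ (U : Bond d (fineP L m) → 𝔸ˣ) (hU : ∀ b, U b ∈ U1 𝔸) {ε : ℝ} (hε : 0 ≤ ε)
      (hεr : ε ≤ 1 / (256 * ((d : ℝ) + 1) ^ 2 * (L : ℝ) ^ (d + 1))), ε ≤ ε₃ → ∀ (hUε : ∀ b, ‖(U b : 𝔸) - 1‖ ≤ ε),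
      (∀ b, star (U b : 𝔸) = (((U b)⁻¹ : 𝔸ˣ) : 𝔸)) →
      ∀ {Wq : Space115 (L : ℝ) η lev₀ lev₁ (nabla115 η U) → NegSize (L : ℝ) η lev₀ 3 𝔸}, QuadAnalytic Wq C₄ a₃ →
        AnalyticOnNhd ℂ Wq {Y | ‖Y‖ < a₃} →
      ∃ hpos : ∀ x : BondL2K ℂ d (fineP L m) c₀ W, x ≠ 0 →
          0 < RCLike.re (inner ℂ x (laplaceAofBackground L m hL φ U (alpha_le_64 hL hε hεr) (perCfg_mem_U1 L m hU)
            (hreg_of_small_bonds L m hU hε hUε) τ η (c₀ := c₀) (c₁ := c₁) a x)),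
        DifferentiableOn ℂ (chartHB (frakGLatticeCLM (lev₀ := lev₀) φ hpos (QtorusW_surjective L m hL U (alpha_le_64 hL hε hεr) (perCfg_mem_U1 L m hU)
              (hreg_of_small_bonds L m hU hε hUε) (alphaL_le_half hL hεr) φ) lev₁ (nabla115 η U))
            0 Wq 0 (fun A' => A' + solA (H1LatticeCLM (lev₀ := lev₀) (levB := levB) φ hpos (QtorusW_surjective L m hL U (alpha_le_64 hL hε hεr)
              (perCfg_mem_U1 L m hU) (hreg_of_small_bonds L m hU hε hUε) (alphaL_le_half hL hεr) φ) lev₁ (nabla115 η U))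
              0 (Cc L m η U lev₀ lev₁ (nabla115 η U) levB) 0 εC A') ε₄
            (H1LatticeCLM (lev₀ := lev₀) (levB := levB) φ hpos (QtorusW_surjective L m hL U (alpha_le_64 hL hε hεr) (perCfg_mem_U1 L m hU)
              (hreg_of_small_bonds L m hU hε hUε) (alphaL_le_half hL hεr) φ) lev₁ (nabla115 η U)))
          (ball (0 : NegSize (L : ℝ) η levB 0 𝔸) Rb) ∧
        MapsTo (chartHB (frakGLatticeCLM (lev₀ := lev₀) φ hpos (QtorusW_surjective L m hL U (alpha_le_64 hL hε hεr) (perCfg_mem_U1 L m hU)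
              (hreg_of_small_bonds L m hU hε hUε) (alphaL_le_half hL hεr) φ) lev₁ (nabla115 η U))
            0 Wq 0 (fun A' => A' + solA (H1LatticeCLM (lev₀ := lev₀) (levB := levB) φ hpos (QtorusW_surjective L m hL U (alpha_le_64 hL hε hεr)
              (perCfg_mem_U1 L m hU) (hreg_of_small_bonds L m hU hε hUε) (alphaL_le_half hL hεr) φ) lev₁ (nabla115 η U))
              0 (Cc L m η U lev₀ lev₁ (nabla115 η U) levB) 0 εC A') ε₄
            (H1LatticeCLM (lev₀ := lev₀) (levB := levB) φ hpos (QtorusW_surjective L m hL U (alpha_le_64 hL hε hεr) (perCfg_mem_U1 L m hU)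
              (hreg_of_small_bonds L m hU hε hUε) (alphaL_le_half hL hεr) φ) lev₁ (nabla115 η U)))
          (ball (0 : NegSize (L : ℝ) η levB 0 𝔸) Rb) (ball (0 : Space115 (L : ℝ) η lev₀ lev₁ (nabla115 η U)) R') ∧
        chartHB (frakGLatticeCLM (lev₀ := lev₀) φ hpos (QtorusW_surjective L m hL U (alpha_le_64 hL hε hεr) (perCfg_mem_U1 L m hU)
              (hreg_of_small_bonds L m hU hε hUε) (alphaL_le_half hL hεr) φ) lev₁ (nabla115 η U))
            0 Wq 0 (fun A' => A' + solA (H1LatticeCLM (lev₀ := lev₀) (levB := levB) φ hpos (QtorusW_surjective L m hL U (alpha_le_64 hL hε hεr)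
              (perCfg_mem_U1 L m hU) (hreg_of_small_bonds L m hU hε hUε) (alphaL_le_half hL hεr) φ) lev₁ (nabla115 η U))
              0 (Cc L m η U lev₀ lev₁ (nabla115 η U) levB) 0 εC A') ε₄
            (H1LatticeCLM (lev₀ := lev₀) (levB := levB) φ hpos (QtorusW_surjective L m hL U (alpha_le_64 hL hε hεr) (perCfg_mem_U1 L m hU)
              (hreg_of_small_bonds L m hU hε hUε) (alphaL_le_half hL hεr) φ) lev₁ (nabla115 η U)) 0 = 0 := by
  obtain ⟨ε₃, hε₃, hle, H⟩ := cur_chart_exists_of_small_bonds L m hL φ hMφ hMφ' hφ hφ' τ hτ hCτ (η := η) (levB := levB) lev₁ hlev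
    (c₀ := c₀) (c₁ := c₁) ha
  refine ⟨ε₃, hε₃, hle, fun {C₄ a₃} hC₄ ha₃ => ?_⟩
  obtain ⟨ε₄, εC, Rb, R', hRb0, hR'0, H'⟩ := H hC₄ ha₃
  refine ⟨ε₄, εC, Rb, R', hRb0, hR'0, ?_⟩
  intro U hU ε hε hεr hεm hUε hUstar Wq hW hWa
  exact H' U hU hε hεr hεm hUε (hRS_of_unitary φ τ hτφ htr U hUstar) hW hWa

end SmallBonds

end Summit.QuantumFields.BalabanUV.T4Continuum.NE9CurChartUniformBall

end
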